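import Summits.ResolutionOfSingularities.ResolutionOfSingularities.Theorems.WildQuotientsSummitReductionStubPairQuasiSplitBaseChangeLemmas3
import Literature.AlgebraicGeometry.Resolution.AlterationsSemiStable
import Literature.AlgebraicGeometry.Resolution.BaseChangeOverOpens
import HarnessLib

/-!
# `WildQuotients.SummitReduction` (stmt-ResolutionOfSingularities-16324), line `FramePerfect`, skeleton v8:
# stub `stub_pair_quasiSplitBaseChange` — quasi-splitness of a semi-stable curve is stable under base change

Route `ResolutionOfSingularities/WildQuotients`, crux `SummitReduction`; registered stub of the line
skeleton `Cruxes/SummitReduction/Lines/FramePerfect.lean` (v8, lead c4), the one hypothesis `hQS`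
left open by the pull-back step 1c (`stub_pair_regularBaseChange_of_quasiSplitBaseChange`).
De Jong 1997, 5.7 and p. 614–615: a semi-stable curve `f : X → Y` is *quasi-split* if the singular
points of its fibres are rational with rational tangents, rendered in the line as: at every point
`x` where `f` is not smooth, the `𝔪`-adic completion of the fibre local ring
`𝒪_{X,x}/𝔪_{f x}𝒪_{X,x}` is ring-isomorphic to `κ(f x)⟦u,v⟧/(uv)` compatibly with the structure maps
from `κ(f x)`. **This property is stable under any base change `X ×_Y Y' → Y'`** ("obviously
stable under extension of the base", loc. cit.):

* `stub_pair_quasiSplitBaseChange` — the registered signature. Proof: smoothness is stable under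
  base change, so a non-smooth point `x'` of `pr₂` lies over a non-smooth point `x` of `f`; on an
  affine chart `Spec (Γ(X,U) ⊗_{Γ(Y,V)} Γ(Y',V')) → X ×_Y Y'` through `x'`
  (`…QuasiSplitBaseChangeLemmas`) the fibre local ring at `x'` is the localisation of
  `κ(y') ⊗_{κ(y)} B`, `B = 𝒪_x/𝔪_y𝒪_x`, at the maximal ideal `𝔪_x(κ(y') ⊗ B)`
  (`…Lemmas2`, `…Lemmas3`), and `(κ(y') ⊗_{κ(y)} B)^ ≅ κ(y')⟦u,v⟧/(uv)` over `κ(y')` since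
  `B^ ≅ κ(y)⟦u,v⟧/(uv)` over `κ(y)` (`…QuasiSplitBaseChangeAlgebra`, `…Levels`).
-/

set_option linter.dupNamespace false

noncomputable section

open CategoryTheory CategoryTheory.Limits AlgebraicGeometry TopologicalSpace TensorProduct
open Literature.AlgebraicGeometry.Resolution
open Literature.AlgebraicGeometry

namespace Summit.ResolutionOfSingularities.ResolutionOfSingularities.Theorems

/-- **Quasi-splitness of a semi-stable curve is stable under base change** (stub QS of the line
`FramePerfect`, the one hypothesis `hQS` left open by the pull-back step 1c). If `f : X → Y` is a
semi-stable curve whose fibres are quasi-split in the sense of de Jong 1997, 5.7 / p. 614 — at every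
point `x` where `f` is not smooth the `𝔪`-adic completion of the fibre local ring
`𝒪_{X,x}/𝔪_{f x}𝒪_{X,x}` is `κ(f x)⟦u,v⟧/(uv)` compatibly with `κ(f x)` ("the singular points of the
fibres are rational with rational tangents") — then so is the pull-back `pr₂ : X ×_Y Y' → Y'` along
any `ψ : Y' → Y`: this is "obviously stable under extension of the base" (de Jong 1997, p. 615).
Proof: a non-smooth point `x'` of `pr₂` lies over a non-smooth point `x = pr₁ x'` of `f` (smoothness
is stable under base change, `ι_comp_pullback_snd_of_ι_comp`); choose affine opens `V ∋ f x`,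
`U ∋ x` over `V`, `V' ∋ pr₂ x'` over `V` and the affine chart
`Spec (Γ(X,U) ⊗_{Γ(Y,V)} Γ(Y',V')) → X ×_Y Y'` through `x'` (`exists_affineChart_pullback`); then
`exists_adicCompletion_equiv_of_affineChart`: the fibre local ring at `x'` is the localisation of
`κ(y') ⊗_{κ(y)} (𝒪_x/𝔪_y𝒪_x)` at the maximal ideal over `𝔪_x` (the point is rational), whose
completion is `(κ(y') ⊗_{κ(y)} κ(y)⟦u,v⟧/(uv))^ = κ(y')⟦u,v⟧/(uv)`. The hypotheses that `f` is
semi-stable and that the schemes are integral are part of the line's interface and not used.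
[cite: DeJong1997, 5.7 and p. 614–615] -/
theorem stub_pair_quasiSplitBaseChange {X Y Y' : Scheme.{0}} [IsIntegral X] [IsIntegral Y]
    [IsIntegral Y'] [IsLocallyNoetherian X] [IsLocallyNoetherian Y'] (f : X ⟶ Y) (ψ : Y' ⟶ Y)
    [IsIntegral (pullback f ψ)] (_hss : IsSemiStableCurve f)
    (hqs : (∀ x : X, (¬ ∃ U : X.Opens, x ∈ U ∧ Smooth (U.ι ≫ f)) →
        ∃ e : AdicCompletion
            ((IsLocalRing.maximalIdeal (X.presheaf.stalk x)).map (Ideal.Quotient.mk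
              ((IsLocalRing.maximalIdeal (Y.presheaf.stalk (f.base x))).map (f.stalkMap x).hom)))
            (X.presheaf.stalk x ⧸
              (IsLocalRing.maximalIdeal (Y.presheaf.stalk (f.base x))).map (f.stalkMap x).hom) ≃+*
          MvPowerSeries (Fin 2) (Y.presheaf.stalk (f.base x) ⧸ IsLocalRing.maximalIdeal (Y.presheaf.stalk (f.base x))) ⧸
            Ideal.span {(MvPowerSeries.X 0 * MvPowerSeries.X 1 :
              MvPowerSeries (Fin 2) (Y.presheaf.stalk (f.base x) ⧸ IsLocalRing.maximalIdeal (Y.presheaf.stalk (f.base x))))},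
          e.toRingHom.comp ((algebraMap (X.presheaf.stalk x ⧸
              (IsLocalRing.maximalIdeal (Y.presheaf.stalk (f.base x))).map (f.stalkMap x).hom) _).comp
            (Ideal.quotientMap ((IsLocalRing.maximalIdeal (Y.presheaf.stalk (f.base x))).map (f.stalkMap x).hom)
              (f.stalkMap x).hom Ideal.le_comap_map)) =
          algebraMap (Y.presheaf.stalk (f.base x) ⧸ IsLocalRing.maximalIdeal (Y.presheaf.stalk (f.base x))) _)) :
    (∀ x : ↥(pullback f ψ), (¬ ∃ U : (pullback f ψ).Opens, x ∈ U ∧ Smooth (U.ι ≫ (pullback.snd f ψ))) →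
      ∃ e : AdicCompletion
          ((IsLocalRing.maximalIdeal ((pullback f ψ).presheaf.stalk x)).map (Ideal.Quotient.mk
            ((IsLocalRing.maximalIdeal (Y'.presheaf.stalk ((pullback.snd f ψ).base x))).map ((pullback.snd f ψ).stalkMap x).hom)))
          ((pullback f ψ).presheaf.stalk x ⧸
            (IsLocalRing.maximalIdeal (Y'.presheaf.stalk ((pullback.snd f ψ).base x))).map ((pullback.snd f ψ).stalkMap x).hom) ≃+*
        MvPowerSeries (Fin 2) (Y'.presheaf.stalk ((pullback.snd f ψ).base x) ⧸ IsLocalRing.maximalIdeal (Y'.presheaf.stalk ((pullback.snd f ψ).base x))) ⧸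
          Ideal.span {(MvPowerSeries.X 0 * MvPowerSeries.X 1 :
            MvPowerSeries (Fin 2) (Y'.presheaf.stalk ((pullback.snd f ψ).base x) ⧸ IsLocalRing.maximalIdeal (Y'.presheaf.stalk ((pullback.snd f ψ).base x))))},
        e.toRingHom.comp ((algebraMap ((pullback f ψ).presheaf.stalk x ⧸
            (IsLocalRing.maximalIdeal (Y'.presheaf.stalk ((pullback.snd f ψ).base x))).map ((pullback.snd f ψ).stalkMap x).hom) _).comp
          (Ideal.quotientMap ((IsLocalRing.maximalIdeal (Y'.presheaf.stalk ((pullback.snd f ψ).base x))).map ((pullback.snd f ψ).stalkMap x).hom)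
            ((pullback.snd f ψ).stalkMap x).hom Ideal.le_comap_map)) =
        algebraMap (Y'.presheaf.stalk ((pullback.snd f ψ).base x) ⧸ IsLocalRing.maximalIdeal (Y'.presheaf.stalk ((pullback.snd f ψ).base x))) _) := by
  intro x' hx'
  -- `x = pr₁ x'` is a non-smooth point of `f`: smoothness is stable under base change
  have hxns : ¬ ∃ U : X.Opens, pullback.fst f ψ x' ∈ U ∧ Smooth (U.ι ≫ f) := by
    rintro ⟨U, hxU, hU⟩
    exact hx' ⟨pullback.fst f ψ ⁻¹ᵁ U, hxU, ι_comp_pullback_snd_of_ι_comp (P := @Smooth) f ψ U hU⟩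
  obtain ⟨ex, hex⟩ := hqs _ hxns
  -- affine charts `V ∋ y`, `U ∋ x` over `V`, `V' ∋ y'` over `V`, and the chart of `X ×_Y Y'` through `x'`
  have hyy : f (pullback.fst f ψ x') = ψ (pullback.snd f ψ x') := by
    rw [← Scheme.Hom.comp_apply, pullback.condition, Scheme.Hom.comp_apply]
  obtain ⟨V, hV, hyV, -⟩ := exists_isAffineOpen_mem_and_subset (X := Y) (x := f (pullback.fst f ψ x'))
    (U := ⊤) trivial
  obtain ⟨U, hU, hxU, hUV⟩ := exists_isAffineOpen_mem_and_subset (X := X) (x := pullback.fst f ψ x')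
    (U := f ⁻¹ᵁ V) hyV
  obtain ⟨V', hV', hy'V', hV'V⟩ := exists_isAffineOpen_mem_and_subset (X := Y') (x := pullback.snd f ψ x')
    (U := ψ ⁻¹ᵁ V) (show ψ (pullback.snd f ψ x') ∈ V by rw [← hyy]; exact hyV)
  replace hUV : U ≤ f ⁻¹ᵁ V := hUV
  replace hV'V : V' ≤ ψ ⁻¹ᵁ V := hV'V
  letI algC : Algebra Γ(Y, V) Γ(X, U) := (f.appLE V U hUV).hom.toAlgebra
  letI algA' : Algebra Γ(Y, V) Γ(Y', V') := (ψ.appLE V V' hV'V).hom.toAlgebra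
  obtain ⟨χ, t, hχ, rfl, hS1, hS2⟩ :=
    exists_affineChart_pullback f ψ hV hU hUV hV' hV'V rfl rfl x' hxU hy'V'
  haveI := hχ
  exact exists_adicCompletion_equiv_of_affineChart (pullback.fst f ψ) (pullback.snd f ψ) f ψ pullback.condition
    hU hUV hV' hV'V rfl rfl χ t hS1 hS2 ex hex

end Summit.ResolutionOfSingularities.ResolutionOfSingularities.Theorems

end
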